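/-
Copyright (c) 2026 the pub-hodgecm-mathlib formalisation cell (harness21).  Prover seat hodgecm-mathlib-F0P3a-p02 (g16), 2026-09-01.  «S3-ram» seeding wave (LEAD F0P3a-plan (g12)
T11-41 ∕ T11-62; owner∕desk F0P3a-p06 (g15) `S3RAM-ORGANS.md`, row «TYPE-(2) DESCENT PARITY»; dedup path ref5 (g4) R-265 ∕ R-267: THIN COMPLEMENT over ★ p847095).
-/
import Literature.NumberTheory.Automorphic.UnitaryTwoDescentDiscriminantRamified   -- ★ p847095 A-p12 (g23): `valued_disc_div_trace_sq_of_descent`, `exists_eq_uniformizer_mul_sq_of_odd`, `exists_eq_nonsquare_unit_mul_sq_of_even`, `not_isSquare_disc_of_descent_of_not_exists_isRoot`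
import Literature.NumberTheory.Automorphic.ProjectiveDescentLatticeLevelsDischarge  -- ★ F0P3a-p04: `v_det_eq_one_of_mem_unitaryGroupOfForm_antidiag_two`, `eq_exp_of_pow_eq_exp_nsmul`; the `Valued`∕`ValuativeRel` bridge
import Literature.NumberTheory.Automorphic.AdicCompletionLocalField                 -- ★ `instIsNonarchimedeanLocalFieldAdicCompletion` (finite residue field of `𝒪[L⁺_v]`)
import HarnessLib

/-!
# Type-(2) descent parity at a TAME-RAMIFIED place, ONE CALL: from `u ∈ U(σ_w, Φ₂)`, `χ_u` rootless, `|tr²u − 4det u|_w = exp(−2N)` and a (W1) descent datum to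
# `tr g ≠ 0` and `tr²g − 4det g = ε₀·z²` (`N = 2n`) or `π₁·z²` (`N = 2n + 1`) — WITHOUT a tube hypothesis (Labesse–Langlands 1979 §2 p. 8; Serre, *Local Fields* XIV §4)

Topic `NumberTheory/Rogawski1990`; namespace `Literature.NumberTheory.Rogawski1990`.  THEOREMS ONLY (no definition, no instance, no notation, no named fact, no `sorry`;
axioms ⊆ {propext, Classical.choice, Quot.sound}); kernel lane `--supports stmt-HodgeConjecture-24833`, count-neutral.  Cell `pub/hodgecm-mathlib` (D-0151), crux H413;
«S3-ram» seeding wave, organ «TYPE-(2) DESCENT PARITY» — the THIN COMPLEMENT (ref5 (g4) R-265 ∕ R-267 dedup path) of A-p12 (g23)'s ★ `UnitaryTwoDescentDiscriminantRamified`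
(p847095), which holds the descent algebra and the square-class dichotomy; this file adds ONLY what that file does not have.  HONEST LABEL: HC_CM is proved only modulo the cell's
2 remaining named inputs (hLiu418 24832, h413 24833) until rung 0 closes; nothing printed is asserted here — valuation bookkeeping.

WHAT IS ADDED.  (§1, any `ℤᵐ⁰`-valued field) **the tube-free trace lemma** `valued_trace_eq_one_of_valued_disc_lt_one`: `|det u| = 1`, `|tr²u − 4det u| < 1`, `|2| = 1` ⟹
`|tr u| = 1` (ultrametric: `|tr²u| = |(tr²u − 4det u) + 4det u| = |4 det u| = 1`), and its depth-token form `…_of_valued_disc_eq_exp_neg` (`|tr²u − 4det u| = exp(−2N)`, `N ≥ 1`) —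
this DISCHARGES the binder `htrU : |tr u|_w = 1` of ★ `valued_disc_div_trace_sq_of_descent` from the depth token alone, so no `K_H(ϖ_v)`-tube guard is needed for it.  (§2, at a
tame-ramified non-split place of the CM extension `L ∕ L⁺`) **the ONE-CALL head** `descent_trace_ne_zero_and_parity_of_mem_unitaryGroupOfForm_of_ramified`, keyed on
`hu : u ∈ U(σ_w, !![0,1;1,0])`, `hirr`, the depth token `hN` (+ `1 ≤ N`), ANY descent datum `hdesc : diag(1,α)·u·diag(1,α)⁻¹ = s·ι_w(g)` of ★ (W1) `exists_conj_diagonal_eq_smul_map_toPlace`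
(`α ≠ 0`), a unit `ε₀` of non-square residue (`hns`) and a uniformiser `ϖ` of `L⁺_v`: **`tr g ≠ 0`, and EITHER `N = 2n ∧ tr²g − 4det g = ε₀·z² ∧ z ≠ 0 ∧ |z·(tr g)⁻¹|_v = |ϖ|_vⁿ`
(the class `[g]` fixes a VERTEX ball of radius `n`: feed ★ `ncard_setOf_glVertexAct_eq_self_of_unramified_elliptic`) OR `N = 2n + 1 ∧ tr²g − 4det g = π₁·z² ∧ |π₁|_v = |ϖ|_v ∧ …`
(an EDGE ball)** — `|det u|_w = 1` from unitarity (★ `v_det_eq_one_of_mem_unitaryGroupOfForm_antidiag_two`), `|tr u|_w = 1` from §1, then ★ p847095's §2–§4 assembled.  (§3) the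
EVEN branch in the TREE currency of the consumer heads (`hns : ∀ b ∈ 𝒪[L⁺_v], valuation (b² − ε₀) = 1`, conclusion `valuation (z·t⁻¹) = valuation ϖ ^ n`, ★ bridge).

## References
* [LabesseLanglands1979] J.-P. Labesse, R. P. Langlands, *L-indistinguishability for SL(2)*, Canad. J. Math. 31 (1979), §2 p. 8 (the elliptic tori of `SL₂(F)` for the
  unramified and the ramified quadratic extension and their fixed points in the tree).
* [Serre1979] J.-P. Serre, *Local Fields*, GTM 67 (1979): Ch. II §2 (`e = 2`), Ch. XIV §4 (square classes, `p` odd).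
* [Serre1980Trees] J.-P. Serre, *Trees* (1980), Ch. II §1.1–§1.3 (vertices and edges; `GL₂` acts through `PGL₂`).
* [Rogawski1990] J. D. Rogawski, *Automorphic Representations of Unitary Groups in Three Variables*, Ann. of Math. Stud. 123 (1990), §3.6 p. 31 (the tori of `U(1,1)`).
-/

set_option autoImplicit false

noncomputable section

open Matrix NumberField IsDedekindDomain WithZero ValuativeRel
open scoped Matrix MatrixGroups WithZero ValuativeRel

namespace Literature.NumberTheory.Rogawski1990

open Literature.NumberTheory.Automorphic Literature.NumberTheory.Automorphic.UnitaryGroup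

/-! ## §1 The tube-free trace lemma over a `ℤᵐ⁰`-valued field -/

section Valued

variable {K : Type*} [Field K] [Valued K ℤᵐ⁰]

/-- **TUBE-FREE TRACE LEMMA**: in a `ℤᵐ⁰`-valued field with `|2| = 1`, a `2 × 2` matrix with `|det u| = 1` and `|tr²u − 4 det u| < 1` has `|tr u| = 1` — ultrametric:
`|tr²u| = |(tr²u − 4det u) + 4 det u| = |4 det u| = 1`.  (So «deepness of the trace» follows from the depth of the discriminant; no congruence hypothesis on `u` is needed.)
[cite: Serre1979, Ch. XIV §4] [cite: LabesseLanglands1979, §2 p. 8] -/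
theorem valued_trace_eq_one_of_valued_disc_lt_one (h2 : Valued.v (2 : K) = 1) {u : Matrix (Fin 2) (Fin 2) K} (hdet : Valued.v u.det = 1)
    (hdisc : Valued.v (u.trace ^ 2 - 4 * u.det) < 1) : Valued.v u.trace = 1 := by
  have h4 : Valued.v (4 * u.det) = 1 := by
    rw [map_mul, show (4 : K) = 2 ^ 2 by norm_num, map_pow, h2, one_pow, hdet, one_mul]
  have hsq : Valued.v u.trace ^ 2 = exp (2 • (0 : ℤ)) := by
    rw [← map_pow, show u.trace ^ 2 = (u.trace ^ 2 - 4 * u.det) + 4 * u.det by ring, Valued.v.map_add_eq_of_lt_right (by rw [h4]; exact hdisc), h4,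
      smul_zero, exp_zero]
  rw [eq_exp_of_pow_eq_exp_nsmul two_ne_zero hsq, exp_zero]

/-- **TUBE-FREE TRACE LEMMA, depth-token form**: `|det u| = 1`, `|tr²u − 4 det u| = exp(−2N)` with `1 ≤ N`, `|2| = 1` ⟹ `|tr u| = 1` (the binder `htrU` of ★
`valued_disc_div_trace_sq_of_descent`, discharged from the (α₂) depth token). [cite: Serre1979, Ch. XIV §4] [cite: LabesseLanglands1979, §2 p. 8] -/
theorem valued_trace_eq_one_of_valued_disc_eq_exp_neg (h2 : Valued.v (2 : K) = 1) {u : Matrix (Fin 2) (Fin 2) K} (hdet : Valued.v u.det = 1)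
    {N : ℕ} (hN1 : 1 ≤ N) (hN : Valued.v (u.trace ^ 2 - 4 * u.det) = exp (-((2 * N : ℕ) : ℤ))) : Valued.v u.trace = 1 := by
  refine valued_trace_eq_one_of_valued_disc_lt_one h2 hdet ?_
  rw [hN, ← exp_zero, exp_lt_exp]
  omega

end Valued

/-! ## §2 The ONE-CALL head at a tame-ramified non-split place of `L ∕ L⁺` -/

section Place

variable (L : Type) [Field L] [NumberField L] [IsCMField L] (v : HeightOneSpectrum (𝓞 ↥(maximalRealSubfield L)))
  (w : PlacesOver L v) (hw : IsCMField.complexConj L • w.1 = w.1)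

include hw in
/-- `|2|_w = 1` from `|2|_v = 1` at a ramified place (`|ι 2|_w = |2|_v²`); in particular `(2 : L_w) ≠ 0`. [cite: Serre1979, Ch. II §2] -/
theorem valued_two_eq_one_of_ramified (he : v.asIdeal.ramificationIdx' w.1.asIdeal ≠ 1) (h2 : Valued.v (2 : v.adicCompletion ↥(maximalRealSubfield L)) = 1) :
    Valued.v (2 : w.1.adicCompletion L) = 1 ∧ (2 : w.1.adicCompletion L) ≠ 0 := by
  have h : Valued.v (2 : w.1.adicCompletion L) = 1 := by
    rw [← map_ofNat (toPlace v w) 2, valued_toPlace_eq_sq_of_ramified L v w hw he, h2, one_pow]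
  exact ⟨h, fun h0 => zero_ne_one (by rw [h0, map_zero] at h; exact h)⟩

include hw in
set_option maxHeartbeats 400000 in
/-- **TYPE-(2) DESCENT PARITY AT A TAME-RAMIFIED PLACE (one call, no tube hypothesis).**  `w ∣ v` non-split and ramified in the CM extension `L ∕ L⁺` (`he`), `|2|_v = 1` (`h2`);
`u ∈ U(σ_w, Φ₂)(L_w)` (`hu`) whose characteristic polynomial has NO root in `L_w` (`hirr`, the type-(2) guard) and with `|tr²u − 4 det u|_w = exp(−2N)`, `1 ≤ N` (the (α₂) depth
token); `diag(1,α)·u·diag(1,α)⁻¹ = s·ι_w(g)` ANY descent datum of ★ (W1) `exists_conj_diagonal_eq_smul_map_toPlace` (`α ≠ 0`); `ε₀ ∈ L⁺_v` a unit of NON-SQUARE residue in the tree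
heads' spelling `hns : ∀ b, |b| ≤ 1 → |b² − ε₀| = 1`; `ϖ` a uniformiser of `L⁺_v`.  Then with `t := tr g`, `d := det g`: **`t ≠ 0`**, and EITHER `N = 2n` and `t² − 4d = ε₀·z²`, `z ≠ 0`,
`|z·t⁻¹|_v = |ϖ|_vⁿ` — `[g]` is UNRAMIFIED-elliptic and fixes the VERTEX ball of radius `n` (feed ★ `ncard_setOf_glVertexAct_eq_self_of_unramified_elliptic (htr) (hdet) (ht) (hz) (hD) (hn)`) —
OR `N = 2n + 1` and `t² − 4d = π₁·z²`, `|π₁|_v = |ϖ|_v`, `z ≠ 0`, `|z·t⁻¹|_v = |ϖ|_vⁿ` — RAMIFIED-elliptic, an EDGE ball of radius `n`.  Assembly: `|det u|_w = 1` (★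
`v_det_eq_one_of_mem_unitaryGroupOfForm_antidiag_two`), `|tr u|_w = 1` (§1, tube-free), ★ `valued_disc_div_trace_sq_of_descent`, then ★ `exists_eq_uniformizer_mul_sq_of_odd` ∕ ★
`not_isSquare_disc_of_descent_of_not_exists_isRoot` + ★ `exists_eq_nonsquare_unit_mul_sq_of_even` (A-p12 (g23), p847095).
[cite: LabesseLanglands1979, §2 p. 8] [cite: Serre1979, Ch. XIV §4] [cite: Serre1980Trees, Ch. II §1.1–§1.3] [cite: Rogawski1990, §3.6 p. 31] -/
theorem descent_trace_ne_zero_and_parity_of_mem_unitaryGroupOfForm_of_ramified (he : v.asIdeal.ramificationIdx' w.1.asIdeal ≠ 1)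
    (h2 : Valued.v (2 : v.adicCompletion ↥(maximalRealSubfield L)) = 1)
    {u : GL (Fin 2) (w.1.adicCompletion L)}
    (hu : u ∈ unitaryGroupOfForm (galAdicCompletionMap (L := L) (IsCMField.complexConj L) hw) !![(0 : w.1.adicCompletion L), 1; 1, 0])
    (hirr : ¬ ∃ x : w.1.adicCompletion L, (u : Matrix (Fin 2) (Fin 2) (w.1.adicCompletion L)).charpoly.IsRoot x) {N : ℕ} (hN1 : 1 ≤ N)
    (hN : Valued.v ((u : Matrix (Fin 2) (Fin 2) (w.1.adicCompletion L)).trace ^ 2 - 4 * (u : Matrix (Fin 2) (Fin 2) (w.1.adicCompletion L)).det) =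
      exp (-((2 * N : ℕ) : ℤ)))
    {α s : w.1.adicCompletion L} (hα0 : α ≠ 0) {g : Matrix (Fin 2) (Fin 2) (v.adicCompletion ↥(maximalRealSubfield L))}
    (hdesc : diagonal ![1, α] * (u : Matrix (Fin 2) (Fin 2) (w.1.adicCompletion L)) * diagonal ![1, α⁻¹] = s • g.map (toPlace v w))
    {ε₀ : v.adicCompletion ↥(maximalRealSubfield L)} (hns : ∀ b : v.adicCompletion ↥(maximalRealSubfield L), Valued.v b ≤ 1 → Valued.v (b ^ 2 - ε₀) = 1)
    {ϖ : v.adicCompletion ↥(maximalRealSubfield L)} (hϖ : Valued.v ϖ = exp (-1 : ℤ)) :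
    g.trace ≠ 0 ∧
    ((∃ n : ℕ, N = 2 * n ∧ ∃ z : v.adicCompletion ↥(maximalRealSubfield L), z ≠ 0 ∧ g.trace ^ 2 - 4 * g.det = ε₀ * z ^ 2 ∧
        Valued.v (z * (g.trace)⁻¹) = Valued.v ϖ ^ n) ∨
     (∃ n : ℕ, N = 2 * n + 1 ∧ ∃ π₁ z : v.adicCompletion ↥(maximalRealSubfield L), Valued.v π₁ = Valued.v ϖ ∧ z ≠ 0 ∧ g.trace ^ 2 - 4 * g.det = π₁ * z ^ 2 ∧
        Valued.v (z * (g.trace)⁻¹) = Valued.v ϖ ^ n)) := by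
  -- unitarity and the tube-free trace lemma upstairs
  have hdetU : Valued.v (u : Matrix (Fin 2) (Fin 2) (w.1.adicCompletion L)).det = 1 :=
    v_det_eq_one_of_mem_unitaryGroupOfForm_antidiag_two _ (fun x => valued_galAdicCompletionMap L (IsCMField.complexConj L) hw x) hu
  obtain ⟨h2w, h2w0⟩ := valued_two_eq_one_of_ramified L v w hw he h2
  have htrU : Valued.v (u : Matrix (Fin 2) (Fin 2) (w.1.adicCompletion L)).trace = 1 := valued_trace_eq_one_of_valued_disc_eq_exp_neg h2w hdetU hN1 hN
  -- the depth downstairs (★ p847095 §2)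
  obtain ⟨ht, hm⟩ := valued_disc_div_trace_sq_of_descent L v w hw he hα0 hdesc hdetU htrU hN
  refine ⟨ht, ?_⟩
  obtain ⟨n, hn | hn⟩ := Nat.even_or_odd' N
  · -- EVEN: `hirr` forbids a square downstairs; Serre's index two (★ p847095 §3–§4)
    subst hn
    have hε1 : Valued.v ε₀ = 1 := by
      have h := hns 0 (by rw [map_zero]; exact zero_le)
      rwa [zero_pow two_ne_zero, zero_sub, Valuation.map_neg] at h
    have hD := not_isSquare_disc_of_descent_of_not_exists_isRoot L v w h2w0 hα0 hdesc hirr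
    exact Or.inl ⟨n, rfl, exists_eq_nonsquare_unit_mul_sq_of_even L v h2 ht hϖ hm hD hε1.le hns⟩
  · -- ODD: the uniformiser class (★ p847095 §3)
    subst hn
    exact Or.inr ⟨n, rfl, exists_eq_uniformizer_mul_sq_of_odd L v ht hϖ hm⟩

/-! ## §3 The EVEN branch in the tree currency (`𝒪[L⁺_v]`, `valuation`) of ★ `ncard_setOf_glVertexAct_eq_self_of_unramified_elliptic` -/

include hw in
set_option maxHeartbeats 400000 in
/-- **EVEN BRANCH, TREE CURRENCY**: under the hypotheses of the one-call head with `N = 2n`, and `hns` spelled `∀ b ∈ 𝒪[L⁺_v], valuation (b² − ε₀) = 1` (the consumer head's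
binder VERBATIM): `tr g ≠ 0 ∧ ∃ z ≠ 0, tr²g − 4det g = ε₀·z² ∧ valuation (z·(tr g)⁻¹) = valuation ϖ ^ n` — the binders `(ht) (hz) (hD) (hn)` of ★
`ncard_setOf_glVertexAct_eq_self_of_unramified_elliptic` (★ bridge `v_le_one_iff_mem_integer`, `v_eq_one_iff_valuation_eq_one`, `v_eq_iff_valuation_eq`).
[cite: LabesseLanglands1979, §2 p. 8] [cite: Serre1979, Ch. XIV §4] -/
theorem descent_trace_ne_zero_and_exists_eq_nonsquare_mul_sq_of_even_of_ramified (he : v.asIdeal.ramificationIdx' w.1.asIdeal ≠ 1)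
    (h2 : Valued.v (2 : v.adicCompletion ↥(maximalRealSubfield L)) = 1)
    {u : GL (Fin 2) (w.1.adicCompletion L)}
    (hu : u ∈ unitaryGroupOfForm (galAdicCompletionMap (L := L) (IsCMField.complexConj L) hw) !![(0 : w.1.adicCompletion L), 1; 1, 0])
    (hirr : ¬ ∃ x : w.1.adicCompletion L, (u : Matrix (Fin 2) (Fin 2) (w.1.adicCompletion L)).charpoly.IsRoot x) {n : ℕ} (hn1 : 1 ≤ n)
    (hN : Valued.v ((u : Matrix (Fin 2) (Fin 2) (w.1.adicCompletion L)).trace ^ 2 - 4 * (u : Matrix (Fin 2) (Fin 2) (w.1.adicCompletion L)).det) =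
      exp (-((2 * (2 * n) : ℕ) : ℤ)))
    {α s : w.1.adicCompletion L} (hα0 : α ≠ 0) {g : Matrix (Fin 2) (Fin 2) (v.adicCompletion ↥(maximalRealSubfield L))}
    (hdesc : diagonal ![1, α] * (u : Matrix (Fin 2) (Fin 2) (w.1.adicCompletion L)) * diagonal ![1, α⁻¹] = s • g.map (toPlace v w))
    {ε₀ : v.adicCompletion ↥(maximalRealSubfield L)}
    (hns : ∀ b : v.adicCompletion ↥(maximalRealSubfield L), b ∈ 𝒪[v.adicCompletion ↥(maximalRealSubfield L)] →
      valuation (v.adicCompletion ↥(maximalRealSubfield L)) (b ^ 2 - ε₀) = 1)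
    {ϖ : v.adicCompletion ↥(maximalRealSubfield L)} (hϖ : Valued.v ϖ = exp (-1 : ℤ)) :
    g.trace ≠ 0 ∧ ∃ z : v.adicCompletion ↥(maximalRealSubfield L), z ≠ 0 ∧ g.trace ^ 2 - 4 * g.det = ε₀ * z ^ 2 ∧
      valuation (v.adicCompletion ↥(maximalRealSubfield L)) (z * (g.trace)⁻¹) = valuation (v.adicCompletion ↥(maximalRealSubfield L)) ϖ ^ n := by
  have hns' : ∀ b : v.adicCompletion ↥(maximalRealSubfield L), Valued.v b ≤ 1 → Valued.v (b ^ 2 - ε₀) = 1 := fun b hb =>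
    (v_eq_one_iff_valuation_eq_one _).2 (hns b ((v_le_one_iff_mem_integer b).1 hb))
  obtain ⟨ht, h⟩ := descent_trace_ne_zero_and_parity_of_mem_unitaryGroupOfForm_of_ramified L v w hw he h2 hu hirr (by omega) hN hα0 hdesc hns' hϖ
  refine ⟨ht, ?_⟩
  rcases h with ⟨n', hn', z, hz, hD, hv⟩ | ⟨n', hn', -⟩
  · have hnn : n' = n := by omega
    subst hnn
    refine ⟨z, hz, hD, ?_⟩
    rw [← map_pow]
    exact (v_eq_iff_valuation_eq _ _).1 (by rw [map_pow]; exact hv)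
  · exfalso
    omega

end Place

end Literature.NumberTheory.Rogawski1990

end
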